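import Literature.MathematicalPhysics.StatisticalMechanics.LennardJonesClusters
import Mathlib.Analysis.InnerProductSpace.PiL2
import Mathlib.Topology.Order.Compact
import HarnessLib

/-!
# Exponential-size `ε`-nets of the unit ball and the net bound for bilinear forms

Topic `Analysis/Convexity`, companion of `UnitBallNets.lean` (whose grid net has `(√n/ε + 2)ⁿ`
points — too many for union bounds at the scale `√n`). Two fully PROVED, Mathlib-style lemmas:

* `exists_net_unitBall_card_le` — **volumetric net**: in an `n`-dimensional real normed space, for
  every `ε > 0` there is a finite set `N` of vectors of norm `≤ 1`, `#N ≤ (2/ε + 1)ⁿ`, such that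
  every vector of norm `≤ 1` is within distance `< ε` of `N` (Vershynin 2018, Lemma 4.2.6 and
  Cor. 4.2.13: a maximal `ε`-separated subset is an `ε`-net, counted by the volume/packing bound — here the
  tree's `Literature.MathematicalPhysics.StatisticalMechanics.card_le_of_separated_of_dist_le`).
* `bilin_le_of_net` — **from the net to all vectors** for a continuous bilinear form `β` on a
  proper real normed space: if `β a b ≤ τ` on a `1/4`-net `N` of the unit ball (`N` inside the
  ball), then `β x y ≤ 2τ ‖x‖ ‖y‖` for all `x, y` (Vershynin 2018, Lemma 4.4.1 / Ex. 4.4.3, the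
  quadratic-form step of the `ε`-net method for operator norms; proved via the maximum of `β` on
  the compact product of unit balls: `L ≤ τ + L/4 + L/4`).

These are the two deterministic inputs of the `ε`-net bound on the norm of a random sign matrix
(`Literature/Probability/RandomMatrix/RandomSignMatrixNorm.lean`).

## References

* R. Vershynin, *High-Dimensional Probability*, Cambridge Univ. Press 2018 (2nd ed. 2026, same
  numbering, `lit read book:vershynin2026-…`), Lemma 4.2.6 (nets from separated sets), Cor. 4.2.13
  (`𝒩(B₂ⁿ, ε) ≤ (2/ε+1)ⁿ`), Lemma 4.4.1 and Exercise 4.4.3 (operator norm / quadratic form on a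
  net) [Vershynin2018].
* J. Matoušek, *Lectures on Discrete Geometry*, GTM 212 (2002), §13.1, Lemma 13.1.1 (volume
  argument) [Matousek2002].
-/

noncomputable section

open Finset Metric Module

namespace Literature.Analysis.Convexity

open Literature.MathematicalPhysics.StatisticalMechanics

/-! ### Nets from maximal separated sets -/

/-- **Volumetric `ε`-net of the unit ball.** In a finite-dimensional real normed space of
dimension `n`, for every `ε > 0` there is a finite set `N` of vectors of norm `≤ 1` with
`#N ≤ (2/ε + 1)ⁿ` such that every vector of norm `≤ 1` is at distance `< ε` from some point of
`N`. Proof: an `ε`-separated subset of the ball has at most `(2/ε + 1)ⁿ` points (packing by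
volume), so one of maximal cardinality exists, and maximality makes it an `ε`-net.
[cite: Vershynin2018, Lemma 4.2.6 and Cor. 4.2.13] -/
theorem exists_net_unitBall_card_le {E : Type*} [NormedAddCommGroup E] [NormedSpace ℝ E]
    [FiniteDimensional ℝ E] {ε : ℝ} (hε : 0 < ε) :
    ∃ N : Finset E, (∀ a ∈ N, ‖a‖ ≤ 1) ∧ ((N.card : ℝ) ≤ (2 / ε + 1) ^ finrank ℝ E) ∧
      ∀ x : E, ‖x‖ ≤ 1 → ∃ a ∈ N, ‖x - a‖ < ε := by
  classical
  -- admissible sets: inside the ball and `ε`-separated; they are uniformly bounded in size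
  have hbound : ∀ A : Finset E, (∀ a ∈ A, ‖a‖ ≤ 1) →
      (∀ a ∈ A, ∀ b ∈ A, a ≠ b → ε ≤ dist a b) → (A.card : ℝ) ≤ (2 / ε + 1) ^ finrank ℝ E := by
    intro A h1 h2
    have h := card_le_of_separated_of_dist_le A 0 hε zero_le_one
      (fun c hc => by simpa using h1 c hc) h2
    simpa using h
  set B : ℕ := ⌊(2 / ε + 1 : ℝ) ^ finrank ℝ E⌋₊ with hB
  let P : ℕ → Prop := fun m => ∃ A : Finset E, (∀ a ∈ A, ‖a‖ ≤ 1) ∧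
    (∀ a ∈ A, ∀ b ∈ A, a ≠ b → ε ≤ dist a b) ∧ A.card = m
  have hPB : ∀ m, P m → m ≤ B := by
    rintro m ⟨A, h1, h2, rfl⟩
    exact Nat.le_floor (hbound A h1 h2)
  have hP0 : P 0 := ⟨∅, by simp, by simp, rfl⟩
  obtain ⟨A, hA1, hA2, hAcard⟩ : P (Nat.findGreatest P B) := Nat.findGreatest_spec (Nat.zero_le B) hP0
  refine ⟨A, hA1, hbound A hA1 hA2, fun x hx => ?_⟩
  by_contra hcon
  push Not at hcon
  have hxA : x ∉ A := fun hxA => by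
    have h := hcon x hxA
    rw [sub_self, norm_zero] at h
    exact absurd h (not_le.2 hε)
  have hP' : P (Nat.findGreatest P B + 1) := by
    refine ⟨insert x A, ?_, ?_, by rw [card_insert_of_notMem hxA, hAcard]⟩
    · intro a ha
      rcases mem_insert.1 ha with rfl | ha
      · exact hx
      · exact hA1 a ha
    · intro a ha b hb hab
      rw [mem_insert] at ha hb
      rcases ha with rfl | ha' <;> rcases hb with rfl | hb'
      · exact absurd rfl hab
      · rw [dist_eq_norm]; exact hcon _ hb'
      · rw [dist_comm, dist_eq_norm]; exact hcon _ ha'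
      · exact hA2 _ ha' _ hb' hab
  have h := Nat.le_findGreatest (hPB _ hP') hP'
  omega

/-! ### From a net to all vectors, for bilinear forms -/

/-- Scaling in the first argument: if `β v w ≤ L` whenever `‖v‖, ‖w‖ ≤ 1`, then
`β v w ≤ L ‖v‖` for all `v` and `‖w‖ ≤ 1`. [folklore] -/
theorem bilin_le_mul_norm_left {E : Type*} [NormedAddCommGroup E] [NormedSpace ℝ E]
    (β : E →ₗ[ℝ] E →ₗ[ℝ] ℝ) {L : ℝ} (hL : ∀ v w : E, ‖v‖ ≤ 1 → ‖w‖ ≤ 1 → β v w ≤ L)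
    (v w : E) (hw : ‖w‖ ≤ 1) : β v w ≤ L * ‖v‖ := by
  rcases eq_or_ne v 0 with rfl | hv
  · simp
  have hvn : 0 < ‖v‖ := norm_pos_iff.2 hv
  have hu : ‖‖v‖⁻¹ • v‖ ≤ 1 := by
    rw [norm_smul, norm_inv, norm_norm, inv_mul_cancel₀ hvn.ne']
  have h := hL (‖v‖⁻¹ • v) w hu hw
  rw [LinearMap.map_smul₂, smul_eq_mul] at h
  calc β v w = ‖v‖ * (‖v‖⁻¹ * β v w) := by field_simp
    _ ≤ ‖v‖ * L := by gcongr
    _ = L * ‖v‖ := mul_comm _ _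

/-- Scaling in both arguments: if `β v w ≤ L` on the unit ball, then `β v w ≤ L ‖v‖ ‖w‖`
everywhere. [folklore] -/
theorem bilin_le_mul_norm_mul_norm {E : Type*} [NormedAddCommGroup E] [NormedSpace ℝ E]
    (β : E →ₗ[ℝ] E →ₗ[ℝ] ℝ) {L : ℝ} (hL : ∀ v w : E, ‖v‖ ≤ 1 → ‖w‖ ≤ 1 → β v w ≤ L)
    (v w : E) : β v w ≤ L * ‖v‖ * ‖w‖ := by
  rcases eq_or_ne w 0 with rfl | hw
  · simp
  have hwn : 0 < ‖w‖ := norm_pos_iff.2 hw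
  have hu : ‖‖w‖⁻¹ • w‖ ≤ 1 := by
    rw [norm_smul, norm_inv, norm_norm, inv_mul_cancel₀ hwn.ne']
  have h := bilin_le_mul_norm_left β hL v (‖w‖⁻¹ • w) hu
  rw [LinearMap.map_smul, smul_eq_mul] at h
  calc β v w = ‖w‖ * (‖w‖⁻¹ * β v w) := by field_simp
    _ ≤ ‖w‖ * (L * ‖v‖) := by gcongr
    _ = L * ‖v‖ * ‖w‖ := by ring

/-- **The net bound for bilinear forms** (the `ε`-net method for operator norms, `ε = 1/4`): let
`β` be a continuous bilinear form on a proper real normed space, `N` a finite subset of the unit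
ball such that every vector of norm `≤ 1` is within `1/4` of `N`, and `β a b ≤ τ` for all
`a, b ∈ N`. Then `β x y ≤ 2τ ‖x‖ ‖y‖` for all `x, y`. (With `L = max β` over the product of unit
balls, attained by compactness, `L ≤ τ + L/4 + L/4`.)
[cite: Vershynin2018, Lemma 4.4.1 and Exercise 4.4.3] -/
theorem bilin_le_of_net {E : Type*} [NormedAddCommGroup E] [NormedSpace ℝ E] [ProperSpace E]
    (β : E →ₗ[ℝ] E →ₗ[ℝ] ℝ) (hβ : Continuous fun p : E × E => β p.1 p.2)
    {N : Finset E} (hN1 : ∀ a ∈ N, ‖a‖ ≤ 1)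
    (hnet : ∀ x : E, ‖x‖ ≤ 1 → ∃ a ∈ N, ‖x - a‖ ≤ 1 / 4)
    {τ : ℝ} (hτ : ∀ a ∈ N, ∀ b ∈ N, β a b ≤ τ) (x y : E) :
    β x y ≤ 2 * τ * ‖x‖ * ‖y‖ := by
  -- the maximum of `β` on the (compact) product of closed unit balls
  set K : Set (E × E) := closedBall (0 : E) 1 ×ˢ closedBall (0 : E) 1 with hK
  have hKc : IsCompact K := (isCompact_closedBall 0 1).prod (isCompact_closedBall 0 1)
  have hKne : K.Nonempty := ⟨(0, 0), by simp [hK]⟩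
  obtain ⟨p, hpK, hpmax⟩ := hKc.exists_isMaxOn hKne hβ.continuousOn
  set L : ℝ := β p.1 p.2 with hLdef
  have hL : ∀ v w : E, ‖v‖ ≤ 1 → ‖w‖ ≤ 1 → β v w ≤ L := by
    intro v w hv hw
    have h := hpmax (show (v, w) ∈ K by simp [hK, hv, hw])
    simpa using h
  have hL0 : 0 ≤ L := by simpa using hL 0 0 (by simp) (by simp)
  have hp1 : ‖p.1‖ ≤ 1 := by
    have := hpK.1; simpa [hK] using this
  have hp2 : ‖p.2‖ ≤ 1 := by
    have := hpK.2; simpa [hK] using this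
  -- `L ≤ τ + L/4 + L/4`
  obtain ⟨a, ha, hpa⟩ := hnet p.1 hp1
  obtain ⟨b, hb, hpb⟩ := hnet p.2 hp2
  have hsplit : L = β a b + β (p.1 - a) p.2 + β a (p.2 - b) := by
    rw [hLdef, map_sub, LinearMap.sub_apply, map_sub]
    ring
  have h1 : β (p.1 - a) p.2 ≤ L * (1 / 4) :=
    (bilin_le_mul_norm_left β hL _ _ hp2).trans (mul_le_mul_of_nonneg_left hpa hL0)
  have h2 : β a (p.2 - b) ≤ L * (1 / 4) := by
    have h := bilin_le_mul_norm_mul_norm β hL a (p.2 - b)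
    calc β a (p.2 - b) ≤ L * ‖a‖ * ‖p.2 - b‖ := h
      _ ≤ L * 1 * (1 / 4) := by gcongr; exact hN1 a ha
      _ = L * (1 / 4) := by ring
  have hLτ : L ≤ 2 * τ := by
    have := hτ a ha b hb
    linarith [hsplit, h1, h2]
  -- conclude by scaling
  calc β x y ≤ L * ‖x‖ * ‖y‖ := bilin_le_mul_norm_mul_norm β hL x y
    _ ≤ 2 * τ * ‖x‖ * ‖y‖ := by gcongr

end Literature.Analysis.Convexity

end
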